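import Literature.MathematicalPhysics.QuantumLattice.HubbardLangerMattisChain
import HarnessLib

/-!
# Kernel-certified values of the Langer–Mattis bound: exact lattice moments and a cubic majorant

Topic `MathematicalPhysics/QuantumLattice`, family `hubbard`. `HubbardLangerMattisTorus.lean` proves

  `energyDensity2D t U n ≥ (U/2) n - U/4 - (2π)⁻² ∫_{[-π,π]²} √(ε(p)² + U²/16) dp`,
  `ε(p) = 2t(cos p₁ + cos p₂)`,

the thermodynamic limit of the finite-torus bounds `Σ_k √(ε_k² + U²/16)` [LangerMattis1971,
eqs. (3)–(5)]. The integral is not elementary. Here its value is BOUNDED IN THE KERNEL, with no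
quadrature: on every torus `(ℤ/Lℤ)²` with `L ≥ 7` the even moments of the band are exact,

  `L⁻² Σ_k ε_k² = 4t²`, `L⁻² Σ_k ε_k⁴ = 36t⁴`, `L⁻² Σ_k ε_k⁶ = 400t⁶`

(`C(2j, j)²`, the numbers of closed walks; from the one-dimensional cosine power sums
`Σ_{a ∈ ℤ/L} cos^m(2πa/L) = L, 0, L/2, 0, 3L/8, ·, 5L/16`, i.e. orthogonality of characters), and the
square root has the cubic majorant `√y ≤ r + (y - r²)/(2r) - (y - r²)²/(8r³) + (y - r²)³/(16r⁵)` for all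
`y ≥ 0`, `r > 0` (the third-order Taylor polynomial at `y = r²`; the difference of squares is
`(y - r²)⁴((y - 3r²)² + 16r⁴)/(256 r¹⁰) ≥ 0`). Averaging the majorant with the exact moments gives, for
every `r > 0` and every `L ≥ 7`,

  `L⁻² Σ_k √(ε_k² + U²/16) ≤ lmMomentBound t U r`   (an explicit rational function),

hence `(2π)⁻² ∫ √(ε² + U²/16) ≤ lmMomentBound t U r` and the KERNEL-ONLY thermodynamic-limit bounds
`energyDensity2D t U n ≥ (U/2) n - U/4 - lmMomentBound t U r` (`energyDensity2D_ge_lmMomentBound`); at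
`t = 1`, half filling: `e(U=2) ≥ -1.3855`, `e(4) ≥ -1.0897`, `e(6) ≥ -0.88655`, `e(8) ≥ -0.74512`,
`e(12) ≥ -0.56077` (the exact Langer–Mattis values being `-1.2601, -1.0256, -0.8573, -0.7313, -0.5579`).
The same for the half-filled CHAIN (`HubbardLangerMattisChain.lean`, moments `2t², 6t⁴, 20t⁶`):
`hubbardChainEnergyDensity t U ≥ U/4 - lmMomentBoundChain t U r`, at `t = 1`:
`e₁(2) ≥ -0.9279`, `e₁(4) ≥ -0.68398`, `e₁(6) ≥ -0.53324`, `e₁(8) ≥ -0.43311`, `e₁(12) ≥ -0.30985`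
(Langer–Mattis' 1D curve: `-0.9028, -0.6776, -0.5314, -0.4320, -0.3097`; these are the tree's only
unconditional numerical statements on `hubbardChainEnergyDensity`, whose exact value is the named fact
`lieb_wu`).

## References

* W. D. Langer, D. C. Mattis, Phys. Lett. 36A (1971) 139–140, eqs. (3)–(5). [LangerMattis1971]
* T. Kennedy, E. H. Lieb, Physica A 138 (1986) 320–358, Theorem 2.1. [KennedyLieb1986]
* I. S. Gradshteyn, I. M. Ryzhik, *Table of Integrals, Series, and Products* (8th ed., Zwillinger–Moll), §1.320.5 / 1.320.7 — power-reduction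
  formulas for `cos^{2n} x`, `cos^{2n-1} x` (bibkey `GradshteynRyzhik2015`; used for the 8th cosine power sum / band moment below).

## Mathlib / tree search

Tree (REUSED): `LangerMattis.hubbardTorus_groundEnergyAt_ge`, `lmIntegrand`, `continuous_lmIntegrand`,
`lmIntegrand_add_pi`, `sum_latticeMomentum_div_eq_cornerRiemannSum` (part 2), `hubbardChainEnergyDensity_ge`
(part 3);
`Literature.Probability.LatticeModels.stdAddChar_mul_eq_exp`, `latticeMomentum`,
`tendsto_cornerRiemannSum`, `ThermodynamicLimit.tendsto_energyDensity2D_torus`, `tendsto_rectN_div_sq`,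
`rectN_le_two_mul`. Mathlib: `AddChar.sum_mulShift`, `ZMod.isPrimitive_stdAddChar`,
`Complex.exp_ofReal_mul_I_re`, `Real.cos_sq`, `Real.cos_two_mul`, `Real.cos_three_mul`, `piFinTwoEquiv`.
-/

noncomputable section

namespace Literature.MathematicalPhysics.QuantumLattice

namespace LangerMattis

open Filter Finset Literature.Probability.LatticeModels ThermodynamicLimit
open scoped Topology

variable {L : ℕ} [NeZero L]

/-! ### Cosine power sums over `ℤ/Lℤ` -/

/-- **Orthogonality of characters, real part**: `Σ_{a ∈ ℤ/L} cos(j · 2πa/L) = 0` for `0 < j < L`.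
[folklore] -/
theorem sum_cos_mul_angle_eq_zero {j : ℕ} (hj : 0 < j) (hjL : j < L) :
    ∑ a : ZMod L, Real.cos ((j : ℝ) * (2 * Real.pi * ((a.val : ℕ) : ℝ) / L)) = 0 := by
  have hval : ((j : ZMod L)).val = j := ZMod.val_cast_of_lt hjL
  have hne : (j : ZMod L) ≠ 0 := by
    intro h
    rw [ZMod.natCast_eq_zero_iff] at h
    exact absurd (Nat.le_of_dvd hj h) (not_le.2 hjL)
  have hsum := AddChar.sum_mulShift (j : ZMod L) (ZMod.isPrimitive_stdAddChar L)
  rw [if_neg hne, Nat.cast_zero] at hsum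
  have hre := congrArg Complex.re hsum
  rw [Complex.re_sum, Complex.zero_re] at hre
  rw [← hre]
  refine Finset.sum_congr rfl fun a _ => ?_
  rw [stdAddChar_mul_eq_exp, hval]
  have h : (2 * (Real.pi : ℂ) * Complex.I * ((((a.val * j : ℕ) : ℝ) : ℝ) : ℂ) / (L : ℂ)) =
      (((j : ℝ) * (2 * Real.pi * ((a.val : ℕ) : ℝ) / L) : ℝ) : ℂ) * Complex.I := by
    push_cast
    ring
  rw [h, Complex.exp_ofReal_mul_I_re]

/-- `Σ_a cos(2πa/L) = 0` (`L ≥ 2`). [folklore] -/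
theorem sum_cos_angle (hL : 2 ≤ L) :
    ∑ a : ZMod L, Real.cos (2 * Real.pi * ((a.val : ℕ) : ℝ) / L) = 0 := by
  have h := sum_cos_mul_angle_eq_zero (L := L) (j := 1) Nat.one_pos (by omega)
  simpa only [Nat.cast_one, one_mul] using h

/-- `Σ_a cos²(2πa/L) = L/2` (`L ≥ 3`). [folklore] -/
theorem sum_cos_angle_sq (hL : 3 ≤ L) :
    ∑ a : ZMod L, Real.cos (2 * Real.pi * ((a.val : ℕ) : ℝ) / L) ^ 2 = (L : ℝ) / 2 := by
  have h2 := sum_cos_mul_angle_eq_zero (L := L) (j := 2) (by norm_num) (by omega)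
  push_cast at h2
  have key : ∀ a : ZMod L, Real.cos (2 * Real.pi * ((a.val : ℕ) : ℝ) / L) ^ 2 =
      1 / 2 + Real.cos (2 * (2 * Real.pi * ((a.val : ℕ) : ℝ) / L)) / 2 := fun a => Real.cos_sq _
  simp_rw [key]
  rw [Finset.sum_add_distrib, Finset.sum_const, Finset.card_univ, ZMod.card, ← Finset.sum_div, h2]
  simp only [nsmul_eq_mul]
  ring

/-- `Σ_a cos³(2πa/L) = 0` (`L ≥ 4`). [folklore] -/
theorem sum_cos_angle_pow_three (hL : 4 ≤ L) :
    ∑ a : ZMod L, Real.cos (2 * Real.pi * ((a.val : ℕ) : ℝ) / L) ^ 3 = 0 := by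
  have h1 := sum_cos_angle (L := L) (by omega)
  have h3 := sum_cos_mul_angle_eq_zero (L := L) (j := 3) (by norm_num) (by omega)
  push_cast at h3
  have key : ∀ a : ZMod L, Real.cos (2 * Real.pi * ((a.val : ℕ) : ℝ) / L) ^ 3 =
      (3 * Real.cos (2 * Real.pi * ((a.val : ℕ) : ℝ) / L) +
        Real.cos (3 * (2 * Real.pi * ((a.val : ℕ) : ℝ) / L))) / 4 := fun a => by
    rw [Real.cos_three_mul]
    ring
  simp_rw [key]
  rw [← Finset.sum_div, Finset.sum_add_distrib, ← Finset.mul_sum, h1, h3]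
  ring

/-- `Σ_a cos⁴(2πa/L) = 3L/8` (`L ≥ 5`). [folklore] -/
theorem sum_cos_angle_pow_four (hL : 5 ≤ L) :
    ∑ a : ZMod L, Real.cos (2 * Real.pi * ((a.val : ℕ) : ℝ) / L) ^ 4 = 3 * (L : ℝ) / 8 := by
  have h2 := sum_cos_mul_angle_eq_zero (L := L) (j := 2) (by norm_num) (by omega)
  have h4 := sum_cos_mul_angle_eq_zero (L := L) (j := 4) (by norm_num) (by omega)
  push_cast at h2 h4
  have key : ∀ a : ZMod L, Real.cos (2 * Real.pi * ((a.val : ℕ) : ℝ) / L) ^ 4 =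
      3 / 8 + Real.cos (2 * (2 * Real.pi * ((a.val : ℕ) : ℝ) / L)) / 2 +
        Real.cos (4 * (2 * Real.pi * ((a.val : ℕ) : ℝ) / L)) / 8 := fun a => by
    set θ := 2 * Real.pi * ((a.val : ℕ) : ℝ) / L
    have e4 : Real.cos (4 * θ) = 2 * Real.cos (2 * θ) ^ 2 - 1 := by
      rw [show (4 : ℝ) * θ = 2 * (2 * θ) by ring]
      exact Real.cos_two_mul _
    rw [e4, Real.cos_two_mul]
    ring
  simp_rw [key]
  rw [Finset.sum_add_distrib, Finset.sum_add_distrib, Finset.sum_const, Finset.card_univ, ZMod.card,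
    ← Finset.sum_div, ← Finset.sum_div, h2, h4]
  simp only [nsmul_eq_mul]
  ring

/-- `Σ_a cos⁶(2πa/L) = 5L/16` (`L ≥ 7`). [folklore] -/
theorem sum_cos_angle_pow_six (hL : 7 ≤ L) :
    ∑ a : ZMod L, Real.cos (2 * Real.pi * ((a.val : ℕ) : ℝ) / L) ^ 6 = 5 * (L : ℝ) / 16 := by
  have h2 := sum_cos_mul_angle_eq_zero (L := L) (j := 2) (by norm_num) (by omega)
  have h4 := sum_cos_mul_angle_eq_zero (L := L) (j := 4) (by norm_num) (by omega)
  have h6 := sum_cos_mul_angle_eq_zero (L := L) (j := 6) (by norm_num) (by omega)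
  push_cast at h2 h4 h6
  have key : ∀ a : ZMod L, Real.cos (2 * Real.pi * ((a.val : ℕ) : ℝ) / L) ^ 6 =
      5 / 16 + 15 * Real.cos (2 * (2 * Real.pi * ((a.val : ℕ) : ℝ) / L)) / 32 +
        3 * Real.cos (4 * (2 * Real.pi * ((a.val : ℕ) : ℝ) / L)) / 16 +
        Real.cos (6 * (2 * Real.pi * ((a.val : ℕ) : ℝ) / L)) / 32 := fun a => by
    set θ := 2 * Real.pi * ((a.val : ℕ) : ℝ) / L
    have e4 : Real.cos (4 * θ) = 2 * Real.cos (2 * θ) ^ 2 - 1 := by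
      rw [show (4 : ℝ) * θ = 2 * (2 * θ) by ring]
      exact Real.cos_two_mul _
    have e6 : Real.cos (6 * θ) = 2 * Real.cos (3 * θ) ^ 2 - 1 := by
      rw [show (6 : ℝ) * θ = 2 * (3 * θ) by ring]
      exact Real.cos_two_mul _
    rw [e4, e6, Real.cos_two_mul, Real.cos_three_mul]
    ring
  simp_rw [key]
  rw [Finset.sum_add_distrib, Finset.sum_add_distrib, Finset.sum_add_distrib, Finset.sum_const,
    Finset.card_univ, ZMod.card, ← Finset.sum_div, ← Finset.sum_div, ← Finset.sum_div,
    ← Finset.mul_sum, ← Finset.mul_sum, h2, h4, h6]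
  simp only [nsmul_eq_mul]
  ring

/-! ### Exact band moments on the torus `(ℤ/Lℤ)²` -/

/-- Sums of products over the two coordinates of `(ℤ/Lℤ)²` factor. [folklore] -/
theorem sum_torusSite_two_mul (f g : ZMod L → ℝ) :
    ∑ k : TorusSite 2 L, f (k 0) * g (k 1) = (∑ a, f a) * ∑ a, g a := by
  rw [Fintype.sum_equiv (piFinTwoEquiv fun _ => ZMod L) (fun k : TorusSite 2 L => f (k 0) * g (k 1))
    (fun ab => f ab.1 * g ab.2) fun k => rfl, Fintype.sum_prod_type, Finset.sum_mul_sum]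

/-- **The even band moments are exact on every torus with `L ≥ 7`**:
`Σ_k (cos p₁ + cos p₂)² = L²`, `Σ_k (cos p₁ + cos p₂)⁴ = (9/4) L²`, `Σ_k (cos p₁ + cos p₂)⁶ = (25/4) L²`
(`p = 2πk/L`; `1, 9/4, 25/4 = C(2j,j)²/4^j`, the closed-walk counts). [folklore] -/
theorem sum_cosSum_pow_two_four_six (hL : 7 ≤ L) :
    (∑ k : TorusSite 2 L, (∑ i, Real.cos (latticeMomentum L k i)) ^ 2 = (L : ℝ) ^ 2) ∧
    (∑ k : TorusSite 2 L, (∑ i, Real.cos (latticeMomentum L k i)) ^ 4 = 9 / 4 * (L : ℝ) ^ 2) ∧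
    (∑ k : TorusSite 2 L, (∑ i, Real.cos (latticeMomentum L k i)) ^ 6 = 25 / 4 * (L : ℝ) ^ 2) := by
  set c : ZMod L → ℝ := fun a => Real.cos (2 * Real.pi * ((a.val : ℕ) : ℝ) / L) with hc
  have hlm : ∀ k : TorusSite 2 L, ∑ i, Real.cos (latticeMomentum L k i) = c (k 0) + c (k 1) :=
    fun k => by rw [Fin.sum_univ_two]; rfl
  have hmon : ∀ i j : ℕ, ∑ k : TorusSite 2 L, c (k 0) ^ i * c (k 1) ^ j =
      (∑ a, c a ^ i) * ∑ a, c a ^ j := fun i j => sum_torusSite_two_mul (fun a => c a ^ i) fun a => c a ^ j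
  have S0 : ∑ a : ZMod L, c a ^ 0 = L := by
    simp only [pow_zero, Finset.sum_const, Finset.card_univ, ZMod.card, nsmul_eq_mul, mul_one]
  have S1 : ∑ a : ZMod L, c a ^ 1 = 0 := by
    simp only [pow_one, hc]
    exact sum_cos_angle (by omega)
  have S2 : ∑ a : ZMod L, c a ^ 2 = (L : ℝ) / 2 := sum_cos_angle_sq (by omega)
  have S3 : ∑ a : ZMod L, c a ^ 3 = 0 := sum_cos_angle_pow_three (by omega)
  have S4 : ∑ a : ZMod L, c a ^ 4 = 3 * (L : ℝ) / 8 := sum_cos_angle_pow_four (by omega)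
  have S6 : ∑ a : ZMod L, c a ^ 6 = 5 * (L : ℝ) / 16 := sum_cos_angle_pow_six hL
  simp_rw [hlm]
  refine ⟨?_, ?_, ?_⟩
  · have key : ∀ k : TorusSite 2 L, (c (k 0) + c (k 1)) ^ 2 =
        c (k 0) ^ 2 * c (k 1) ^ 0 + 2 * (c (k 0) ^ 1 * c (k 1) ^ 1) + c (k 0) ^ 0 * c (k 1) ^ 2 :=
      fun k => by ring
    rw [Finset.sum_congr rfl fun k _ => key k]
    simp only [Finset.sum_add_distrib, ← Finset.mul_sum, hmon, S0, S1, S2]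
    ring
  · have key : ∀ k : TorusSite 2 L, (c (k 0) + c (k 1)) ^ 4 =
        c (k 0) ^ 4 * c (k 1) ^ 0 + 4 * (c (k 0) ^ 3 * c (k 1) ^ 1) + 6 * (c (k 0) ^ 2 * c (k 1) ^ 2) +
          4 * (c (k 0) ^ 1 * c (k 1) ^ 3) + c (k 0) ^ 0 * c (k 1) ^ 4 := fun k => by ring
    rw [Finset.sum_congr rfl fun k _ => key k]
    simp only [Finset.sum_add_distrib, ← Finset.mul_sum, hmon, S0, S1, S2, S3, S4]
    ring
  · have key : ∀ k : TorusSite 2 L, (c (k 0) + c (k 1)) ^ 6 =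
        c (k 0) ^ 6 * c (k 1) ^ 0 + 6 * (c (k 0) ^ 5 * c (k 1) ^ 1) + 15 * (c (k 0) ^ 4 * c (k 1) ^ 2) +
          20 * (c (k 0) ^ 3 * c (k 1) ^ 3) + 15 * (c (k 0) ^ 2 * c (k 1) ^ 4) +
          6 * (c (k 0) ^ 1 * c (k 1) ^ 5) + c (k 0) ^ 0 * c (k 1) ^ 6 := fun k => by ring
    rw [Finset.sum_congr rfl fun k _ => key k]
    simp only [Finset.sum_add_distrib, ← Finset.mul_sum, hmon, S0, S1, S2, S3, S4, S6]
    ring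

/-- `Σ_a cos⁸(2πa/L) = 35 L/128` (`L ≥ 9`, so that the harmonics 2, 4, 6, 8 are nonzero mod `L`): the power-reduction formula
`cos^{2n} x = 2^{-2n} (Σ_{k<n} 2 C(2n,k) cos 2(n−k)x + C(2n,n))` at `n = 4` (`cos⁸ x = 35/128 + (7/16) cos 2x + (7/32) cos 4x + (1/16) cos 6x
+ (1/128) cos 8x`) summed over the `L`-th roots of unity, where every harmonic sums to zero (`sum_cos_mul_angle_eq_zero`).
[cite: GradshteynRyzhik2015, 1.320.5] (8th-moment companions of `sum_cos_angle_pow_six` / `sum_cosSum_pow_two_four_six`; written by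
hubbard-alg L1 seat A (sr-mbsolver-l1-idea-1 g18, `seat1-tools/lean/upstream/LangerMattisMomentsPow8.lean`), upstreamed by lit-4 g13 — used by the
quartic square-root minorants of the D21 Langer–Mattis comparison.) -/
theorem sum_cos_angle_pow_eight (hL : 9 ≤ L) :
    ∑ a : ZMod L, Real.cos (2 * Real.pi * ((a.val : ℕ) : ℝ) / L) ^ 8 = 35 * (L : ℝ) / 128 := by
  have h2 := sum_cos_mul_angle_eq_zero (L := L) (j := 2) (by norm_num) (by omega)
  have h4 := sum_cos_mul_angle_eq_zero (L := L) (j := 4) (by norm_num) (by omega)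
  have h6 := sum_cos_mul_angle_eq_zero (L := L) (j := 6) (by norm_num) (by omega)
  have h8 := sum_cos_mul_angle_eq_zero (L := L) (j := 8) (by norm_num) (by omega)
  push_cast at h2 h4 h6 h8
  have key : ∀ a : ZMod L, Real.cos (2 * Real.pi * ((a.val : ℕ) : ℝ) / L) ^ 8 =
      35 / 128 + 7 * Real.cos (2 * (2 * Real.pi * ((a.val : ℕ) : ℝ) / L)) / 16 +
        7 * Real.cos (4 * (2 * Real.pi * ((a.val : ℕ) : ℝ) / L)) / 32 +
        Real.cos (6 * (2 * Real.pi * ((a.val : ℕ) : ℝ) / L)) / 16 +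
        Real.cos (8 * (2 * Real.pi * ((a.val : ℕ) : ℝ) / L)) / 128 := fun a => by
    set θ := 2 * Real.pi * ((a.val : ℕ) : ℝ) / L
    have e4 : Real.cos (4 * θ) = 2 * Real.cos (2 * θ) ^ 2 - 1 := by
      rw [show (4 : ℝ) * θ = 2 * (2 * θ) by ring]
      exact Real.cos_two_mul _
    have e6 : Real.cos (6 * θ) = 2 * Real.cos (3 * θ) ^ 2 - 1 := by
      rw [show (6 : ℝ) * θ = 2 * (3 * θ) by ring]
      exact Real.cos_two_mul _
    have e8 : Real.cos (8 * θ) = 2 * Real.cos (4 * θ) ^ 2 - 1 := by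
      rw [show (8 : ℝ) * θ = 2 * (4 * θ) by ring]
      exact Real.cos_two_mul _
    rw [e8, e4, e6, Real.cos_two_mul, Real.cos_three_mul]
    ring
  simp_rw [key]
  rw [Finset.sum_add_distrib, Finset.sum_add_distrib, Finset.sum_add_distrib, Finset.sum_add_distrib]
  simp only [Finset.sum_const, Finset.card_univ, ZMod.card, nsmul_eq_mul, ← Finset.sum_div, ← Finset.mul_sum,
    h2, h4, h6, h8]
  ring

/-- **8th band moment on the torus**: `Σ_k (cos p₁ + cos p₂)⁸ = (1225/64) L²` (`L ≥ 9`; `1225/64 = C(8,4)²/4⁴`, the closed-walk count):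
binomial expansion of `(cos p₁ + cos p₂)⁸`, the product structure of the torus sum (`sum_torusSite_two_mul`) and the one-dimensional power sums
`Σ_a cos^{2j}(2πa/L) = C(2j,j) L/4^j` (`j ≤ 4`; odd powers vanish) — each an instance of the power-reduction formula [cite: GradshteynRyzhik2015, 1.320.5]
(with 1.320.7 for the odd powers) summed over the roots of unity. -/
theorem sum_cosSum_pow_eight (hL : 9 ≤ L) :
    ∑ k : TorusSite 2 L, (∑ i, Real.cos (latticeMomentum L k i)) ^ 8 = 1225 / 64 * (L : ℝ) ^ 2 := by
  set c : ZMod L → ℝ := fun a => Real.cos (2 * Real.pi * ((a.val : ℕ) : ℝ) / L) with hc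
  have hlm : ∀ k : TorusSite 2 L, ∑ i, Real.cos (latticeMomentum L k i) = c (k 0) + c (k 1) :=
    fun k => by rw [Fin.sum_univ_two]; rfl
  have hmon : ∀ i j : ℕ, ∑ k : TorusSite 2 L, c (k 0) ^ i * c (k 1) ^ j =
      (∑ a, c a ^ i) * ∑ a, c a ^ j := fun i j =>
    sum_torusSite_two_mul (fun a => c a ^ i) fun a => c a ^ j
  have S0 : ∑ a : ZMod L, c a ^ 0 = L := by
    simp only [pow_zero, Finset.sum_const, Finset.card_univ, ZMod.card, nsmul_eq_mul, mul_one]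
  have S1 : ∑ a : ZMod L, c a ^ 1 = 0 := by
    simp only [pow_one, hc]
    exact sum_cos_angle (by omega)
  have S2 : ∑ a : ZMod L, c a ^ 2 = (L : ℝ) / 2 := sum_cos_angle_sq (by omega)
  have S3 : ∑ a : ZMod L, c a ^ 3 = 0 := sum_cos_angle_pow_three (by omega)
  have S4 : ∑ a : ZMod L, c a ^ 4 = 3 * (L : ℝ) / 8 := sum_cos_angle_pow_four (by omega)
  have S6 : ∑ a : ZMod L, c a ^ 6 = 5 * (L : ℝ) / 16 := sum_cos_angle_pow_six (by omega)
  have S8 : ∑ a : ZMod L, c a ^ 8 = 35 * (L : ℝ) / 128 := sum_cos_angle_pow_eight hL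
  simp_rw [hlm]
  have key : ∀ k : TorusSite 2 L, (c (k 0) + c (k 1)) ^ 8 =
      c (k 0) ^ 8 * c (k 1) ^ 0 + 8 * (c (k 0) ^ 7 * c (k 1) ^ 1) + 28 * (c (k 0) ^ 6 * c (k 1) ^ 2) +
        56 * (c (k 0) ^ 5 * c (k 1) ^ 3) + 70 * (c (k 0) ^ 4 * c (k 1) ^ 4) + 56 * (c (k 0) ^ 3 * c (k 1) ^ 5) +
        28 * (c (k 0) ^ 2 * c (k 1) ^ 6) + 8 * (c (k 0) ^ 1 * c (k 1) ^ 7) + c (k 0) ^ 0 * c (k 1) ^ 8 := fun k => by ring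
  rw [Finset.sum_congr rfl fun k _ => key k]
  simp only [Finset.sum_add_distrib, ← Finset.mul_sum, hmon, S0, S1, S2, S3, S4, S6, S8]
  ring

/-! ### The cubic majorant of the square root -/

/-- **Cubic majorant of `√`**: for `y ≥ 0` and `r > 0`,
`√y ≤ r + (y - r²)/(2r) - (y - r²)²/(8r³) + (y - r²)³/(16r⁵)` (third-order Taylor polynomial of `√` at
`r²`; the square of the right side exceeds `y` by `(y - r²)⁴((y - 3r²)² + 16r⁴)/(256 r¹⁰)`). [folklore] -/
theorem sqrt_le_cubicTaylor {y r : ℝ} (hy : 0 ≤ y) (hr : 0 < r) :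
    Real.sqrt y ≤ r + (y - r ^ 2) / (2 * r) - (y - r ^ 2) ^ 2 / (8 * r ^ 3) +
      (y - r ^ 2) ^ 3 / (16 * r ^ 5) := by
  set q := r + (y - r ^ 2) / (2 * r) - (y - r ^ 2) ^ 2 / (8 * r ^ 3) + (y - r ^ 2) ^ 3 / (16 * r ^ 5)
    with hq
  have hr0 : r ≠ 0 := hr.ne'
  have hq' : q = (5 * r ^ 6 + y * ((y - 5 * r ^ 2 / 2) ^ 2 + 35 * r ^ 4 / 4)) / (16 * r ^ 5) := by
    rw [hq]
    field_simp
    ring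
  have hqpos : 0 < q := by
    rw [hq']
    positivity
  have hsq : q ^ 2 - y = (y - r ^ 2) ^ 4 * ((y - 3 * r ^ 2) ^ 2 + 16 * r ^ 4) / (256 * r ^ 10) := by
    rw [hq]
    field_simp
    ring
  have hle : y ≤ q ^ 2 := by
    have : 0 ≤ q ^ 2 - y := by rw [hsq]; positivity
    linarith
  calc Real.sqrt y ≤ Real.sqrt (q ^ 2) := Real.sqrt_le_sqrt hle
    _ = q := Real.sqrt_sq hqpos.le

/-! ### The moment bound -/

/-- The **moment value of the Langer–Mattis constant**: the cubic majorant `√y ≤ r + …` at `y = ε² + U²/16`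
averaged with the exact band moments `4t², 36t⁴, 400t⁶` of `ε²`:
`lmMomentBound t U r = (5r⁶ + 15r⁴m² - 5r²m⁴ + m⁶ + 4t²(15r⁴ - 10r²m² + 3m⁴) + 36t⁴(3m² - 5r²) + 400t⁶)/(16r⁵)`,
`m = U/4`; an upper bound for `L⁻² Σ_k √(ε_k² + U²/16)` (`L ≥ 7`) and for
`(2π)⁻² ∫ √(ε² + U²/16)`, for every `r > 0`. [folklore] -/
def lmMomentBound (t U r : ℝ) : ℝ :=
  (5 * r ^ 6 + 15 * r ^ 4 * (U / 4) ^ 2 - 5 * r ^ 2 * (U / 4) ^ 4 + (U / 4) ^ 6 +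
      4 * t ^ 2 * (15 * r ^ 4 - 10 * r ^ 2 * (U / 4) ^ 2 + 3 * (U / 4) ^ 4) +
      36 * t ^ 4 * (3 * (U / 4) ^ 2 - 5 * r ^ 2) + 400 * t ^ 6) / (16 * r ^ 5)

/-- **The torus sums of the Langer–Mattis integrand are below the moment bound**: for `L ≥ 7` and
every `r > 0`, `Σ_{k ∈ (ℤ/L)²} √((2t Σ_i cos(2πk_i/L))² + U²/16) ≤ L² · lmMomentBound t U r`. [folklore] -/
theorem sum_lmIntegrand_le_lmMomentBound (hL : 7 ≤ L) (t U : ℝ) {r : ℝ} (hr : 0 < r) :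
    ∑ k : TorusSite 2 L, lmIntegrand t U (latticeMomentum L k) ≤ (L : ℝ) ^ 2 * lmMomentBound t U r := by
  obtain ⟨h2, h4, h6⟩ := sum_cosSum_pow_two_four_six (L := L) hL
  set c : TorusSite 2 L → ℝ := fun k => ∑ i, Real.cos (latticeMomentum L k i) with hc
  have hr0 : r ≠ 0 := hr.ne'
  -- termwise majorant, written as a polynomial in `c_k²`
  have hterm : ∀ k : TorusSite 2 L, lmIntegrand t U (latticeMomentum L k) ≤
      (5 * r ^ 6 + 15 * r ^ 4 * (U / 4) ^ 2 - 5 * r ^ 2 * (U / 4) ^ 4 + (U / 4) ^ 6 +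
        4 * t ^ 2 * (15 * r ^ 4 - 10 * r ^ 2 * (U / 4) ^ 2 + 3 * (U / 4) ^ 4) * c k ^ 2 +
        16 * t ^ 4 * (3 * (U / 4) ^ 2 - 5 * r ^ 2) * c k ^ 4 + 64 * t ^ 6 * c k ^ 6) / (16 * r ^ 5) := by
    intro k
    have hy : 0 ≤ (t * (2 * c k)) ^ 2 + (U / 4) ^ 2 := by positivity
    refine (sqrt_le_cubicTaylor hy hr).trans (le_of_eq ?_)
    field_simp
    ring
  refine (Finset.sum_le_sum fun k _ => hterm k).trans (le_of_eq ?_)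
  rw [← Finset.sum_div, Finset.sum_add_distrib, Finset.sum_add_distrib, Finset.sum_add_distrib,
    Finset.sum_const, Finset.card_univ, ← Finset.mul_sum, ← Finset.mul_sum, ← Finset.mul_sum, h2, h4, h6,
    lmMomentBound]
  have hcard : (Fintype.card (TorusSite 2 L) : ℝ) = (L : ℝ) ^ 2 := by
    rw [Fintype.card_pi, Fin.prod_const, ZMod.card]
    push_cast
    rfl
  rw [nsmul_eq_mul, hcard]
  field_simp
  ring

/-- **The Langer–Mattis integral is below the moment bound**:
`(2π)⁻² ∫_{[-π,π]²} √((2t(cos p₁ + cos p₂))² + U²/16) dp ≤ lmMomentBound t U r` for every `r > 0` (the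
momentum Riemann sums converge to the integral, `tendsto_cornerRiemannSum`). [folklore] -/
theorem integral_lmIntegrand_le_lmMomentBound (t U : ℝ) {r : ℝ} (hr : 0 < r) :
    ((2 * Real.pi) ^ 2)⁻¹ * ∫ p in brillouin 2, lmIntegrand t U p ≤ lmMomentBound t U r := by
  have hF : ContinuousOn (lmIntegrand (d := 2) t U) (brillouin 2) :=
    (continuous_lmIntegrand t U).continuousOn
  have hRS : Tendsto (fun m : ℕ => ((2 * Real.pi) ^ 2)⁻¹ * cornerRiemannSum (lmIntegrand (d := 2) t U) (m + 7))
      atTop (𝓝 (((2 * Real.pi) ^ 2)⁻¹ * ∫ p in brillouin 2, lmIntegrand t U p)) :=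
    ((tendsto_cornerRiemannSum hF).comp (tendsto_add_atTop_nat 7)).const_mul _
  refine le_of_tendsto hRS (Eventually.of_forall fun m => ?_)
  haveI : NeZero (m + 7) := ⟨by omega⟩
  have hL : (0 : ℝ) < ((m + 7 : ℕ) : ℝ) ^ 2 := by positivity
  have h := sum_lmIntegrand_le_lmMomentBound (L := m + 7) (by omega) t U hr
  have havg := sum_latticeMomentum_div_eq_cornerRiemannSum (d := 2) (L := m + 7) (lmIntegrand t U)
    (lmIntegrand_add_pi t U)
  rw [← havg, div_le_iff₀ hL, mul_comm]
  exact h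

/-- **Kernel-only thermodynamic-limit bound.** For `U ≥ 0`, `0 ≤ n < 2`, every real `t` and every
`r > 0`:

  `energyDensity2D t U n ≥ (U/2) n - U/4 - lmMomentBound t U r`

— the Langer–Mattis–Kennedy–Lieb bound with the Brillouin-zone integral replaced by its exact-moment
majorant (no quadrature). [cite: LangerMattis1971, eqs. (3)–(5)][cite: KennedyLieb1986, Theorem 2.1] -/
theorem energyDensity2D_ge_lmMomentBound (t : ℝ) {U : ℝ} (hU : 0 ≤ U) {n : ℝ} (hn0 : 0 ≤ n)
    (hn2 : n < 2) {r : ℝ} (hr : 0 < r) :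
    U / 2 * n - U / 4 - lmMomentBound t U r ≤ energyDensity2D t U n :=
  le_trans (by linarith [integral_lmIntegrand_le_lmMomentBound t U hr]) (energyDensity2D_ge t hU hn0 hn2)

/-! ### Numbers: the half-filled square lattice at `t = 1` -/

/-- **`e(U = 4) ≥ -1.0897`** for the half-filled square-lattice Hubbard model in the thermodynamic
limit (`t = 1`; kernel-only; `r = 5/2`; Langer–Mattis' exact value is `-1.0256`).
[cite: LangerMattis1971, eqs. (3)–(5)] -/
theorem energyDensity2D_one_four_one_ge : (-1.0897 : ℝ) ≤ energyDensity2D 1 4 1 := by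
  have h := energyDensity2D_ge_lmMomentBound 1 (U := 4) (by norm_num) (n := 1) (by norm_num)
    (by norm_num) (r := 5 / 2) (by norm_num)
  have hB : lmMomentBound 1 4 (5 / 2) = 208969 / 100000 := by
    rw [lmMomentBound]
    norm_num
  rw [hB] at h
  linarith

/-- **`e(U = 8) ≥ -0.74512`** (`t = 1`, half filling, kernel-only; `r = 3`; Langer–Mattis: `-0.7313`).
[cite: LangerMattis1971, eqs. (3)–(5)] -/
theorem energyDensity2D_one_eight_one_ge : (-0.74512 : ℝ) ≤ energyDensity2D 1 8 1 := by
  have h := energyDensity2D_ge_lmMomentBound 1 (U := 8) (by norm_num) (n := 1) (by norm_num)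
    (by norm_num) (r := 3) (by norm_num)
  have hB : lmMomentBound 1 8 3 = 10673 / 3888 := by
    rw [lmMomentBound]
    norm_num
  rw [hB] at h
  linarith

/-- **`e(U = 12) ≥ -0.56077`** (`t = 1`, half filling, kernel-only; `r = 19/5`; Langer–Mattis:
`-0.5579`). [cite: LangerMattis1971, eqs. (3)–(5)] -/
theorem energyDensity2D_one_twelve_one_ge : (-0.56077 : ℝ) ≤ energyDensity2D 1 12 1 := by
  have h := energyDensity2D_ge_lmMomentBound 1 (U := 12) (by norm_num) (n := 1) (by norm_num)
    (by norm_num) (r := 19 / 5) (by norm_num)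
  have hB : lmMomentBound 1 12 (19 / 5) = 17633607 / 4952198 := by
    rw [lmMomentBound]
    norm_num
  rw [hB] at h
  linarith

/-- **`e(U = 2) ≥ -1.3855`** (`t = 1`, half filling, kernel-only; `r = 12/5`; Langer–Mattis: `-1.2601`).
[cite: LangerMattis1971, eqs. (3)–(5)] -/
theorem energyDensity2D_one_two_one_ge : (-1.3855 : ℝ) ≤ energyDensity2D 1 2 1 := by
  have h := energyDensity2D_ge_lmMomentBound 1 (U := 2) (by norm_num) (n := 1) (by norm_num)
    (by norm_num) (r := 12 / 5) (by norm_num)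
  have hB : lmMomentBound 1 2 (12 / 5) = 480430501 / 254803968 := by
    rw [lmMomentBound]
    norm_num
  rw [hB] at h
  linarith

/-- **`e(U = 6) ≥ -0.88655`** (`t = 1`, half filling, kernel-only; `r = 14/5`; Langer–Mattis: `-0.8573`).
[cite: LangerMattis1971, eqs. (3)–(5)] -/
theorem energyDensity2D_one_six_one_ge : (-0.88655 : ℝ) ≤ energyDensity2D 1 6 1 := by
  have h := energyDensity2D_ge_lmMomentBound 1 (U := 6) (by norm_num) (n := 1) (by norm_num)
    (by norm_num) (r := 14 / 5) (by norm_num)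
  have hB : lmMomentBound 1 6 (14 / 5) = 1314348429 / 550731776 := by
    rw [lmMomentBound]
    norm_num
  rw [hB] at h
  linarith

/-! ### The chain (`d = 1`) -/

/-- **The even band moments of the ring** (`L ≥ 7`): `Σ_k cos² = L/2`, `Σ_k cos⁴ = 3L/8`,
`Σ_k cos⁶ = 5L/16` over `k ∈ ℤ/Lℤ` (momenta `2πk/L`). [folklore] -/
theorem sum_cosSum_pow_two_four_six_one (hL : 7 ≤ L) :
    (∑ k : TorusSite 1 L, (∑ i, Real.cos (latticeMomentum L k i)) ^ 2 = (L : ℝ) / 2) ∧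
    (∑ k : TorusSite 1 L, (∑ i, Real.cos (latticeMomentum L k i)) ^ 4 = 3 * (L : ℝ) / 8) ∧
    (∑ k : TorusSite 1 L, (∑ i, Real.cos (latticeMomentum L k i)) ^ 6 = 5 * (L : ℝ) / 16) := by
  have hred : ∀ n : ℕ, ∑ k : TorusSite 1 L, (∑ i, Real.cos (latticeMomentum L k i)) ^ n =
      ∑ a : ZMod L, Real.cos (2 * Real.pi * ((a.val : ℕ) : ℝ) / L) ^ n := fun n =>
    Fintype.sum_equiv (Equiv.funUnique (Fin 1) (ZMod L)) _ _ fun k => by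
      rw [Fin.sum_univ_one]
      rfl
  rw [hred, hred, hred]
  exact ⟨sum_cos_angle_sq (by omega), sum_cos_angle_pow_four (by omega), sum_cos_angle_pow_six hL⟩

/-- The **moment value of the one-dimensional Langer–Mattis constant** (band moments `2t², 6t⁴, 20t⁶`):
`(5r⁶ + 15r⁴m² - 5r²m⁴ + m⁶ + 2t²(15r⁴ - 10r²m² + 3m⁴) + 6t⁴(3m² - 5r²) + 20t⁶)/(16r⁵)`, `m = U/4`.
[folklore] -/
def lmMomentBoundChain (t U r : ℝ) : ℝ :=
  (5 * r ^ 6 + 15 * r ^ 4 * (U / 4) ^ 2 - 5 * r ^ 2 * (U / 4) ^ 4 + (U / 4) ^ 6 +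
      2 * t ^ 2 * (15 * r ^ 4 - 10 * r ^ 2 * (U / 4) ^ 2 + 3 * (U / 4) ^ 4) +
      6 * t ^ 4 * (3 * (U / 4) ^ 2 - 5 * r ^ 2) + 20 * t ^ 6) / (16 * r ^ 5)

/-- The ring sums of the Langer–Mattis integrand are below the one-dimensional moment bound
(`L ≥ 7`, `r > 0`). [folklore] -/
theorem sum_lmIntegrand_le_lmMomentBoundChain (hL : 7 ≤ L) (t U : ℝ) {r : ℝ} (hr : 0 < r) :
    ∑ k : TorusSite 1 L, lmIntegrand t U (latticeMomentum L k) ≤ (L : ℝ) * lmMomentBoundChain t U r := by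
  obtain ⟨h2, h4, h6⟩ := sum_cosSum_pow_two_four_six_one (L := L) hL
  set c : TorusSite 1 L → ℝ := fun k => ∑ i, Real.cos (latticeMomentum L k i) with hc
  have hr0 : r ≠ 0 := hr.ne'
  have hterm : ∀ k : TorusSite 1 L, lmIntegrand t U (latticeMomentum L k) ≤
      (5 * r ^ 6 + 15 * r ^ 4 * (U / 4) ^ 2 - 5 * r ^ 2 * (U / 4) ^ 4 + (U / 4) ^ 6 +
        4 * t ^ 2 * (15 * r ^ 4 - 10 * r ^ 2 * (U / 4) ^ 2 + 3 * (U / 4) ^ 4) * c k ^ 2 +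
        16 * t ^ 4 * (3 * (U / 4) ^ 2 - 5 * r ^ 2) * c k ^ 4 + 64 * t ^ 6 * c k ^ 6) / (16 * r ^ 5) := by
    intro k
    have hy : 0 ≤ (t * (2 * c k)) ^ 2 + (U / 4) ^ 2 := by positivity
    refine (sqrt_le_cubicTaylor hy hr).trans (le_of_eq ?_)
    field_simp
    ring
  refine (Finset.sum_le_sum fun k _ => hterm k).trans (le_of_eq ?_)
  rw [← Finset.sum_div, Finset.sum_add_distrib, Finset.sum_add_distrib, Finset.sum_add_distrib,
    Finset.sum_const, Finset.card_univ, ← Finset.mul_sum, ← Finset.mul_sum, ← Finset.mul_sum, h2, h4, h6,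
    lmMomentBoundChain]
  have hcard : (Fintype.card (TorusSite 1 L) : ℝ) = (L : ℝ) := by
    rw [Fintype.card_pi, Fin.prod_const, ZMod.card, pow_one]
  rw [nsmul_eq_mul, hcard]
  field_simp
  ring

/-- `(2π)⁻¹ ∫_{[-π,π]} √((2t cos p)² + U²/16) dp ≤ lmMomentBoundChain t U r` for every `r > 0`. [folklore] -/
theorem integral_lmIntegrand_one_le_lmMomentBoundChain (t U : ℝ) {r : ℝ} (hr : 0 < r) :
    (2 * Real.pi)⁻¹ * ∫ p in brillouin 1, lmIntegrand t U p ≤ lmMomentBoundChain t U r := by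
  have hF : ContinuousOn (lmIntegrand (d := 1) t U) (brillouin 1) :=
    (continuous_lmIntegrand t U).continuousOn
  have hRS : Tendsto (fun m : ℕ => (2 * Real.pi)⁻¹ * cornerRiemannSum (lmIntegrand (d := 1) t U) (m + 7))
      atTop (𝓝 ((2 * Real.pi)⁻¹ * ∫ p in brillouin 1, lmIntegrand t U p)) :=
    ((tendsto_cornerRiemannSum hF).comp (tendsto_add_atTop_nat 7)).const_mul _
  refine le_of_tendsto hRS (Eventually.of_forall fun m => ?_)
  haveI : NeZero (m + 7) := ⟨by omega⟩
  have hL : (0 : ℝ) < ((m + 7 : ℕ) : ℝ) := by positivity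
  have h := sum_lmIntegrand_le_lmMomentBoundChain (L := m + 7) (by omega) t U hr
  have havg := sum_latticeMomentum_div_eq_cornerRiemannSum (d := 1) (L := m + 7) (lmIntegrand t U)
    (lmIntegrand_add_pi t U)
  rw [pow_one, pow_one] at havg
  rw [← havg, div_le_iff₀ hL, mul_comm]
  exact h

/-- **Kernel-only bound for the half-filled chain**: for `U ≥ 0`, every real `t` and every `r > 0`,
`hubbardChainEnergyDensity t U ≥ U/4 - lmMomentBoundChain t U r`.
[cite: LangerMattis1971, eqs. (3)–(5) and Fig. 1][cite: KennedyLieb1986, Theorem 2.1] -/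
theorem hubbardChainEnergyDensity_ge_lmMomentBoundChain (t : ℝ) {U : ℝ} (hU : 0 ≤ U) {r : ℝ}
    (hr : 0 < r) : U / 4 - lmMomentBoundChain t U r ≤ hubbardChainEnergyDensity t U :=
  le_trans (by linarith [integral_lmIntegrand_one_le_lmMomentBoundChain t U hr])
    (hubbardChainEnergyDensity_ge t hU)

/-- **`e₁(U = 4) ≥ -0.68398`** for the half-filled Hubbard chain (`t = 1`, kernel-only; `r = 7/4`;
Langer–Mattis' curve gives `-0.6776`, Lieb–Wu's exact value is `-0.5737`).
[cite: LangerMattis1971, Fig. 1] -/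
theorem hubbardChainEnergyDensity_four_ge : (-0.68398 : ℝ) ≤ hubbardChainEnergyDensity 1 4 := by
  have h := hubbardChainEnergyDensity_ge_lmMomentBoundChain 1 (U := 4) (by norm_num) (r := 7 / 4)
    (by norm_num)
  have hB : lmMomentBoundChain 1 4 (7 / 4) = 1811365 / 1075648 := by
    rw [lmMomentBoundChain]
    norm_num
  rw [hB] at h
  linarith

/-- **`e₁(U = 8) ≥ -0.43311`** (`t = 1`, kernel-only; `r = 23/10`; Langer–Mattis `-0.4320`, Lieb–Wu
`-0.3275`). [cite: LangerMattis1971, Fig. 1] -/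
theorem hubbardChainEnergyDensity_eight_ge : (-0.43311 : ℝ) ≤ hubbardChainEnergyDensity 1 8 := by
  have h := hubbardChainEnergyDensity_ge_lmMomentBoundChain 1 (U := 8) (by norm_num) (r := 23 / 10)
    (by norm_num)
  have hB : lmMomentBoundChain 1 8 (23 / 10) = 501129689 / 205962976 := by
    rw [lmMomentBoundChain]
    norm_num
  rw [hB] at h
  linarith

/-- **`e₁(U = 12) ≥ -0.30985`** (`t = 1`, kernel-only; `r = 16/5`; Langer–Mattis `-0.3097`, Lieb–Wu
`-0.2284`). [cite: LangerMattis1971, Fig. 1] -/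
theorem hubbardChainEnergyDensity_twelve_ge : (-0.30985 : ℝ) ≤ hubbardChainEnergyDensity 1 12 := by
  have h := hubbardChainEnergyDensity_ge_lmMomentBoundChain 1 (U := 12) (by norm_num) (r := 16 / 5)
    (by norm_num)
  have hB : lmMomentBoundChain 1 12 (16 / 5) = 55530041 / 16777216 := by
    rw [lmMomentBoundChain]
    norm_num
  rw [hB] at h
  linarith

/-- **`e₁(U = 2) ≥ -0.9279`** (`t = 1`, kernel-only; `r = 8/5`; Langer–Mattis `-0.9028`, Lieb–Wu
`-0.8444`). [cite: LangerMattis1971, Fig. 1] -/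
theorem hubbardChainEnergyDensity_two_ge : (-0.9279 : ℝ) ≤ hubbardChainEnergyDensity 1 2 := by
  have h := hubbardChainEnergyDensity_ge_lmMomentBoundChain 1 (U := 2) (by norm_num) (r := 8 / 5)
    (by norm_num)
  have hB : lmMomentBoundChain 1 2 (8 / 5) = 47912141 / 33554432 := by
    rw [lmMomentBoundChain]
    norm_num
  rw [hB] at h
  linarith

/-- **`e₁(U = 6) ≥ -0.53324`** (`t = 1`, kernel-only; `r = 2`; Langer–Mattis `-0.5314`, Lieb–Wu
`-0.4195`). [cite: LangerMattis1971, Fig. 1] -/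
theorem hubbardChainEnergyDensity_six_ge : (-0.53324 : ℝ) ≤ hubbardChainEnergyDensity 1 6 := by
  have h := hubbardChainEnergyDensity_ge_lmMomentBoundChain 1 (U := 6) (by norm_num) (r := 2)
    (by norm_num)
  have hB : lmMomentBoundChain 1 6 2 = 66625 / 32768 := by
    rw [lmMomentBoundChain]
    norm_num
  rw [hB] at h
  linarith

end LangerMattis

end Literature.MathematicalPhysics.QuantumLattice
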